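import Literature.NumberTheory.Sieve.SmoothCanonicalPrefix
import Literature.NumberTheory.Sieve.FejerKernelCounting
import HarnessLib

/-!
# Large values of exponential sums over smooth numbers, II: Erdős–Turán for one pair (Harper's Prop. 3, middle)

Topic `Literature/NumberTheory/Sieve`; a PROVED file toward
`Literature.NumberTheory.DiophantineGeometry.XYZUpperHalf` ([Harper2016, Cor. 1]). The middle part
of the proof of Proposition 3 of op. cit. (§4): for a fixed difference `t = θ_r − θ_s`, the sum
`∑_{m ∈ 𝓜} min(x/m, 1/(2‖mt‖))` over the prefixes `𝓜 ⊆ S(y) ∩ (W, Wy]` is at most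
`#𝓜/(2η)` plus `x ∑_{m ∈ 𝓜, ‖mt‖ < η} 1/m`; the latter is organised in dyadic classes
`[U_j, 2U_j)`, and in each class the number of `m` with `‖mt‖ < η` is bounded by the Fejér-kernel
form of the Erdős–Turán inequality (`FejerCounting.card_filter_fract_lt_le`):

`sum_geomBound_prefix_le` — for `1 ≤ W`, `0 < η ≤ 1/4`, `(H+1)η² ≥ 2`:
`∑_{m ∈ 𝓜} min(x/m, 1/(2‖mt‖)) ≤ #𝓜/(2η) + x ∑_{j ≤ log₂ y} U_j⁻¹ (5η N_j + ∑_{0<|d|≤H} |∑_{m ∈ s_j} e(dmt)|/|d|)`,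
`U_j = (⌊W⌋+1)2^j`, `s_j = S(y) ∩ [U_j, 2U_j)`, `N_j = #s_j` (printed with `η = 1/√K`,
`H = J = √K` and the Erdős–Turán inequality proper).

## References

* A. J. Harper, Compositio Math. 152 (2016) 1121–1158, §4, proof of Proposition 3 [Harper2016].
-/

noncomputable section

open Finset Real
open scoped FourierTransform
open Literature.NumberTheory.Sieve.Vinogradov

namespace Literature.NumberTheory.Sieve

/-- `‖u‖ < η ≤ 1/2` implies `{u + η} < 2η`. [folklore] -/
theorem fract_add_lt_of_distInt_lt {u η : ℝ} (hη : η ≤ 1 / 2) (h : distInt u < η) :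
    Int.fract (u + η) < 2 * η := by
  unfold distInt at h
  set k := round u with hk
  have h1 := abs_lt.mp h
  have hlo : (k : ℝ) ≤ u + η := by linarith [h1.1]
  have hhi : u + η < k + 1 := by linarith [h1.2]
  have hf : Int.fract (u + η) = u + η - k := by
    rw [Int.fract_eq_iff]
    refine ⟨by linarith, by linarith, ⟨k, by ring⟩⟩
  rw [hf]; linarith [h1.2]

/-- The dyadic classes `s_j = S(y) ∩ [U, 2U)`. [folklore] -/
def smoothBlock (y U : ℕ) : Finset ℕ :=
  (Finset.Ico U (2 * U)).filter (· ∈ Nat.smoothNumbers (y + 1))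

/-- Membership in `smoothBlock`. [folklore] -/
theorem mem_smoothBlock {y U m : ℕ} :
    m ∈ smoothBlock y U ↔ U ≤ m ∧ m < 2 * U ∧ m ∈ Nat.smoothNumbers (y + 1) := by
  rw [smoothBlock, Finset.mem_filter, Finset.mem_Ico]; tauto

/-- **Erdős–Turán for one difference** (Harper §4, proof of Proposition 3). See the module
docstring. [cite: Harper2016, §4, proof of Proposition 3] -/
theorem sum_geomBound_prefix_le {x W η t : ℝ} {y H : ℕ} (hW1 : 1 ≤ W) (hWx : W ≤ x) (hy : 2 ≤ y)
    (hη0 : 0 < η) (hη4 : η ≤ 1 / 4) (hH : 2 ≤ ((H : ℝ) + 1) * η ^ 2) :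
    ∑ m ∈ prefixSet y W, geomBound (x / m) ((m : ℝ) * t) ≤
      (prefixSet y W).card / (2 * η) +
        x * ∑ j ∈ Finset.range (Nat.log 2 y + 1),
          (1 / ((((⌊W⌋₊ + 1) * 2 ^ j : ℕ) : ℝ))) *
            (5 * η * (smoothBlock y ((⌊W⌋₊ + 1) * 2 ^ j)).card +
              ∑ d ∈ (Finset.Icc (-(H : ℤ)) H).erase 0,
                ‖∑ m ∈ smoothBlock y ((⌊W⌋₊ + 1) * 2 ^ j), (𝐞 ((d : ℝ) * ((m : ℝ) * t)) : ℂ)‖ / |(d : ℝ)|) := by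
  classical
  have hW0 : 0 < W := by linarith
  have hx0 : 0 < x := by linarith
  have hη2 : η ≤ 1 / 2 := by linarith
  have hη1 : η ≤ 1 := by linarith
  set P := prefixSet y W with hP
  -- split by `distInt (m t) ≥ η`
  rw [← Finset.sum_filter_add_sum_filter_not P (fun m : ℕ => η ≤ distInt ((m : ℝ) * t))]
  refine add_le_add ?_ ?_
  · -- `distInt ≥ η`: each term `≤ 1/(2η)`
    calc ∑ m ∈ P.filter (fun m : ℕ => η ≤ distInt ((m : ℝ) * t)), geomBound (x / m) ((m : ℝ) * t)
        ≤ ∑ m ∈ P.filter (fun m : ℕ => η ≤ distInt ((m : ℝ) * t)), (1 / (2 * η)) := by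
          refine Finset.sum_le_sum fun m hm => ?_
          have hd : η ≤ distInt ((m : ℝ) * t) := (Finset.mem_filter.mp hm).2
          have hpos : 0 < distInt ((m : ℝ) * t) := lt_of_lt_of_le hη0 hd
          calc geomBound (x / m) ((m : ℝ) * t) ≤ 1 / (2 * distInt ((m : ℝ) * t)) := geomBound_le_inv _ hpos
            _ ≤ 1 / (2 * η) := one_div_le_one_div_of_le (by positivity) (by linarith)
      _ = (P.filter (fun m : ℕ => η ≤ distInt ((m : ℝ) * t))).card * (1 / (2 * η)) := by
          rw [Finset.sum_const, nsmul_eq_mul]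
      _ ≤ P.card * (1 / (2 * η)) := by
          gcongr; exact Finset.filter_subset _ _
      _ = P.card / (2 * η) := by ring
  · -- `distInt < η`: `≤ x/m`, then dyadic classes and Erdős–Turán
    set Pη := P.filter (fun m : ℕ => ¬ η ≤ distInt ((m : ℝ) * t)) with hPη
    set u₀ : ℕ := ⌊W⌋₊ + 1 with hu₀
    have hu₀0 : 0 < u₀ := by rw [hu₀]; omega
    have hu₀W : W < u₀ := by rw [hu₀]; push_cast; exact Nat.lt_floor_add_one W
    set g : ℕ → ℕ := fun m => Nat.log 2 (m / u₀) with hg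
    have hPmem : ∀ m ∈ P, u₀ ≤ m ∧ (m : ℝ) ≤ W * y ∧ m ∈ Nat.smoothNumbers (y + 1) := by
      intro m hm
      rw [hP, mem_prefixSet hW0.le] at hm
      obtain ⟨h1, h2, h3, -⟩ := hm
      have : ⌊W⌋₊ < m := (Nat.floor_lt hW0.le).mpr h1
      exact ⟨by rw [hu₀]; omega, h2, h3⟩
    have hmaps : ∀ m ∈ Pη, g m ∈ Finset.range (Nat.log 2 y + 1) := by
      intro m hm
      have hmP : m ∈ P := (Finset.mem_filter.mp hm).1
      obtain ⟨-, hmWy, -⟩ := hPmem m hmP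
      rw [Finset.mem_range, Nat.lt_succ_iff, hg]
      apply Nat.log_mono_right
      have : m / u₀ < y := by
        rw [Nat.div_lt_iff_lt_mul hu₀0]
        have h0 : (0 : ℝ) < y := by exact_mod_cast (by omega : 0 < y)
        have : (m : ℝ) < y * u₀ := by nlinarith
        exact_mod_cast this
      exact this.le
    -- class members lie in `smoothBlock y (u₀ 2^j)`
    have hclassmem : ∀ j, ∀ m ∈ Pη.filter (fun m => g m = j),
        m ∈ smoothBlock y (u₀ * 2 ^ j) ∧ distInt ((m : ℝ) * t) < η := by
      intro j m hm
      rw [Finset.mem_filter] at hm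
      obtain ⟨hmPη, hgj⟩ := hm
      rw [hPη, Finset.mem_filter] at hmPη
      obtain ⟨hmP, hnot⟩ := hmPη
      obtain ⟨hmu₀, -, hsm⟩ := hPmem m hmP
      have h1 : 2 ^ j ≤ m / u₀ := by
        rw [← hgj, hg]; exact Nat.pow_log_le_self 2 (Nat.div_pos hmu₀ hu₀0).ne'
      have h2 : m / u₀ < 2 ^ (j + 1) := by
        rw [← hgj, hg]; exact Nat.lt_pow_succ_log_self one_lt_two _
      refine ⟨mem_smoothBlock.mpr ⟨?_, ?_, hsm⟩, not_le.mp hnot⟩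
      · calc u₀ * 2 ^ j ≤ u₀ * (m / u₀) := Nat.mul_le_mul_left _ h1
          _ ≤ m := Nat.mul_div_le m u₀
      · calc m < u₀ * (m / u₀ + 1) := by
              have := Nat.lt_div_mul_add (a := m) hu₀0
              linarith [Nat.div_add_mod m u₀, Nat.mod_lt m hu₀0]
          _ ≤ u₀ * 2 ^ (j + 1) := Nat.mul_le_mul_left _ h2
          _ = 2 * (u₀ * 2 ^ j) := by rw [pow_succ]; ring
    calc ∑ m ∈ Pη, geomBound (x / m) ((m : ℝ) * t)
        ≤ ∑ m ∈ Pη, x / m := Finset.sum_le_sum fun m _ => geomBound_le _ _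
      _ = ∑ j ∈ Finset.range (Nat.log 2 y + 1), ∑ m ∈ Pη.filter (fun m => g m = j), x / m :=
          (Finset.sum_fiberwise_of_maps_to hmaps (f := fun m : ℕ => x / (m : ℝ))).symm
      _ ≤ ∑ j ∈ Finset.range (Nat.log 2 y + 1),
            x * ((1 / (((u₀ * 2 ^ j : ℕ) : ℝ))) *
              (5 * η * (smoothBlock y (u₀ * 2 ^ j)).card +
                ∑ d ∈ (Finset.Icc (-(H : ℤ)) H).erase 0,
                  ‖∑ m ∈ smoothBlock y (u₀ * 2 ^ j), (𝐞 ((d : ℝ) * ((m : ℝ) * t)) : ℂ)‖ / |(d : ℝ)|)) := by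
          refine Finset.sum_le_sum fun j _ => ?_
          set U : ℕ := u₀ * 2 ^ j with hU
          have hU0 : 0 < U := by rw [hU]; positivity
          have hU0r : (0 : ℝ) < U := by exact_mod_cast hU0
          set sj := smoothBlock y U with hsj
          -- `x/m ≤ x/U` on the class, and the class is inside `{m ∈ sj : distInt (mt) < η}`
          have hsub : Pη.filter (fun m => g m = j) ⊆ sj.filter (fun m : ℕ => Int.fract ((m : ℝ) * t - (-η)) < η - (-η)) := by
            intro m hm
            obtain ⟨hmem, hdist⟩ := hclassmem j m hm
            rw [Finset.mem_filter]
            refine ⟨hmem, ?_⟩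
            rw [sub_neg_eq_add, sub_neg_eq_add, show η + η = 2 * η by ring]
            exact fract_add_lt_of_distInt_lt hη2 hdist
          have hET := FejerCounting.card_filter_fract_lt_le (H := H) sj (fun m : ℕ => (m : ℝ) * t)
            (α := -η) (β := η) (δ := η) (by linarith) (by linarith) hη0 hη4 (by nlinarith)
          have hcard_le : ((Pη.filter (fun m => g m = j)).card : ℝ) ≤
              5 * η * sj.card + ∑ d ∈ (Finset.Icc (-(H : ℤ)) H).erase 0,
                ‖∑ m ∈ sj, (𝐞 ((d : ℝ) * ((m : ℝ) * t)) : ℂ)‖ / |(d : ℝ)| := by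
            refine le_trans (by exact_mod_cast Finset.card_le_card hsub) (hET.trans ?_)
            have hN0 : (0 : ℝ) ≤ sj.card := Nat.cast_nonneg _
            have h3 : 2 * (sj.card : ℝ) / ((H + 1) * η) ≤ η * sj.card := by
              rw [div_le_iff₀ (by positivity)]
              have := mul_le_mul_of_nonneg_left hH hN0
              nlinarith
            have : (η - -η) * sj.card + 2 * η * sj.card + 2 * sj.card / ((H + 1) * η) ≤ 5 * η * sj.card := by
              nlinarith
            linarith
          calc ∑ m ∈ Pη.filter (fun m => g m = j), x / m
              ≤ ∑ m ∈ Pη.filter (fun m => g m = j), x / U := by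
                refine Finset.sum_le_sum fun m hm => ?_
                obtain ⟨hmem, -⟩ := hclassmem j m hm
                have hUm : U ≤ m := (mem_smoothBlock.mp hmem).1
                exact div_le_div_of_nonneg_left hx0.le hU0r (by exact_mod_cast hUm)
            _ = (Pη.filter (fun m => g m = j)).card * (x / U) := by rw [Finset.sum_const, nsmul_eq_mul]
            _ ≤ (5 * η * sj.card + ∑ d ∈ (Finset.Icc (-(H : ℤ)) H).erase 0,
                  ‖∑ m ∈ sj, (𝐞 ((d : ℝ) * ((m : ℝ) * t)) : ℂ)‖ / |(d : ℝ)|) * (x / U) :=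
                mul_le_mul_of_nonneg_right hcard_le (by positivity)
            _ = _ := by rw [hsj, hU]; ring
      _ = _ := by rw [← Finset.mul_sum]

end Literature.NumberTheory.Sieve

end
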